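import Summits.Ventures.PercRepro.GenQChargeTwo
import Summits.Ventures.PercRepro.GenQOpenLayersCoreSmall
import Summits.Ventures.PercRepro.Night2StarIdentity

/-!
# PercRepro — the type-`2` window of `(7, 5)` on the core, part A: the shares of the `6`- and `7`-point sets
(night-2, gen 4)

`SevenFiveLowLayersCoreFree` (night-4, `GenQSevenFiveColoopFree`) asks, on the coloop-free rank-`5` flats `G` of a
rank-`7` Core matroid, the type-`2` balance `0 ≤ Jq M G 5 2` for `|G| ≤ 10` and the type-`3` balance.  Part B
(`Night2TwoWindowCore.lean`) proves the type-`2` clause through night-4's charging form `Jq_two_nonneg_of_charge`;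
this part supplies the per-set bounds on the share `w(B)/nb(B)` that a basis `B₀ ⊆ B` receives:

* `coloopsOf_subset_of_mem_basesOf`: every basis inside a spanning set `B` contains the coloops of `M|B`, hence
  `nb_le_choose`: `nb(B) ≤ C(|B| − m(B), q − m(B))`;
* `wTwo_eq` / `wTwo_five_eq`: `w(B) = q/(1 + m(B)) − Φ·dem(B)`; `dem_two_eq_zero_of_card_le_one`: a set whose
  complement has `≤ 1` point is not demanding; `share_nonneg`: every share of a spanning non-basis is `≥ 0`;
* a `6`-point spanning set has `m ≤ 3` (`mTr_le_three_of_card_eq_six`) and `nb ≤ 6 − m`: its share is `≥ 1/36`,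
  and `≥ 5/12` when it is not demanding (`share_six_ge`, `share_six_ge_of_compl_le_one`);
* a `7`-point spanning set has `m ≤ 2` when every line has `≤ 3` points — three coloops would leave a `4`-point
  cyclic part of rank `2`, a `4`-point line (`mTr_le_two_of_card_eq_seven`) — and `nb ≤ C(7 − m, 2)`: its share
  is `≥ 1/20`, and `≥ 1/6` when not demanding (`share_seven_ge`, `share_seven_ge_of_compl_le_one`).

Imports `GenQChargeTwo` (`wTwo`, `nb`, `basesOf`), `GenQOpenLayersCoreSmall` (imported for part B's
`card_le_three_of_line_of_core` / `simple_of_core`; the line bound is a hypothesis here) and `Night2StarIdentity`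
(the coloop bound `mTr_add_two_le_of_spanning_nonbasis`).
-/
namespace PercRepro.Star

open Finset ThmH SixFour GenQ PerFlat NightThree

variable {α : Type*} [DecidableEq α] {M : Matroid α} [M.Finite]

/-! ## Bases inside a spanning set contain its coloops -/

omit [DecidableEq α] in
/-- Membership in `basesOf`. -/
theorem mem_basesOf {G B : Finset α} {q : ℕ} :
    B ∈ basesOf M G q ↔ B ⊆ G ∧ M.eRk (B : Set α) = (q : ℕ∞) ∧ B.card = q := by
  unfold basesOf
  rw [Finset.mem_filter, mem_Rq, and_assoc]

/-- Every basis of `G` inside a rank-`q` set `B` contains the coloops of `M|B`. -/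
theorem coloopsOf_subset_of_mem_basesOf {G B B₀ : Finset α} {q : ℕ} (hB : B ⊆ gr M)
    (hrB : M.eRk (B : Set α) = (q : ℕ∞)) (hB₀ : B₀ ∈ basesOf M G q) (hsub : B₀ ⊆ B) :
    coloopsOf M B ⊆ B₀ := by
  intro c hc
  have hc' := mem_coloopsOf.1 hc
  by_contra hcB₀
  have hsub' : B₀ ⊆ B.erase c := by
    intro x hx
    exact Finset.mem_erase.2 ⟨fun h => hcB₀ (h ▸ hx), hsub hx⟩
  have h1 := eRk_erase_add_one_of_notMem_closure hB hc'.1 hc'.2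
  have h2 : M.eRk (B₀ : Set α) ≤ M.eRk ((B.erase c : Finset α) : Set α) :=
    M.eRk_mono (Finset.coe_subset.2 hsub')
  obtain ⟨k, hk⟩ := exists_eRk_eq_nat (M := M) (B.erase c)
  rw [hk, hrB] at h1
  rw [hk, (mem_basesOf.1 hB₀).2.1] at h2
  have h1' : k + 1 = q := by exact_mod_cast h1
  have h2' : q ≤ k := by exact_mod_cast h2
  omega

/-- `nb(B) ≤ C(|B| − m(B), q − m(B))`: a basis inside `B` is the coloops of `B` plus `q − m(B)` further points. -/
theorem nb_le_choose {G B : Finset α} {q : ℕ} (hB : B ⊆ gr M) (hrB : M.eRk (B : Set α) = (q : ℕ∞)) :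
    nb M G B q ≤ (B.card - mTr M B).choose (q - mTr M B) := by
  unfold nb
  have hKB : coloopsOf M B ⊆ B := coloopsOf_subset B
  have hmTr : mTr M B = (coloopsOf M B).card := rfl
  calc ((basesOf M G q).filter (fun B₀ => B₀ ⊆ B)).card
      ≤ ((B \ coloopsOf M B).powersetCard (q - (coloopsOf M B).card)).card := by
        apply Finset.card_le_card_of_injOn (fun B₀ => B₀ \ coloopsOf M B)
        · intro B₀ hB₀
          have hB₀' := Finset.mem_filter.1 hB₀
          have hK := coloopsOf_subset_of_mem_basesOf hB hrB hB₀'.1 hB₀'.2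
          rw [Finset.mem_coe, Finset.mem_powersetCard]
          refine ⟨Finset.sdiff_subset_sdiff hB₀'.2 (Finset.Subset.refl _), ?_⟩
          rw [Finset.card_sdiff_of_subset hK, (mem_basesOf.1 hB₀'.1).2.2]
        · intro B₀ hB₀ B₁ hB₁ h
          have hB₀' := Finset.mem_filter.1 (Finset.mem_coe.1 hB₀)
          have hB₁' := Finset.mem_filter.1 (Finset.mem_coe.1 hB₁)
          have hK₀ := coloopsOf_subset_of_mem_basesOf hB hrB hB₀'.1 hB₀'.2
          have hK₁ := coloopsOf_subset_of_mem_basesOf hB hrB hB₁'.1 hB₁'.2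
          simp only at h
          rw [← Finset.sdiff_union_of_subset hK₀, ← Finset.sdiff_union_of_subset hK₁, h]
    _ = (B \ coloopsOf M B).card.choose (q - (coloopsOf M B).card) := Finset.card_powersetCard _ _
    _ = (B.card - mTr M B).choose (q - mTr M B) := by rw [Finset.card_sdiff_of_subset hKB, hmTr]

/-! ## The type-`2` term through the coloop count and the demand -/

/-- `w(B) = q/(1 + m(B)) − Φ·dem(B)`. -/
theorem wTwo_eq (G B : Finset α) (q : ℕ) :
    wTwo M G B q = (q : ℚ) * (1 / (1 + (mTr M B : ℚ))) - (((q : ℚ) + 2) / ((q : ℚ) + 1)) * GenQ.dem M G 2 B := by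
  unfold wTwo wInf
  push_cast
  ring

/-- `0 ≤ dem`. -/
theorem dem_nonneg (G : Finset α) (t : ℕ) (B : Finset α) : 0 ≤ GenQ.dem M G t B := by
  unfold GenQ.dem
  split_ifs <;> norm_num

/-- `dem ≤ 1`. -/
theorem dem_le_one (G : Finset α) (t : ℕ) (B : Finset α) : GenQ.dem M G t B ≤ 1 := by
  unfold GenQ.dem
  split_ifs <;> norm_num

/-- A set whose complement in `G` has at most one point is not demanding at type `2`. -/
theorem dem_two_eq_zero_of_card_le_one {G B : Finset α} (h : (G \ B).card ≤ 1) : GenQ.dem M G 2 B = 0 := by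
  unfold GenQ.dem
  rw [if_pos]
  have h1 : M.eRk ((G \ B : Finset α) : Set α) ≤ ((G \ B).card : ℕ∞) := by
    have := M.eRk_le_encard ((G \ B : Finset α) : Set α)
    rwa [Set.encard_coe_eq_coe_finsetCard] at this
  have h2 : ((G \ B).card : ℕ∞) ≤ 1 := by exact_mod_cast h
  calc M.eRk ((G \ B : Finset α) : Set α) + 1 ≤ 1 + 1 := add_le_add (h1.trans h2) le_rfl
    _ = ((2 : ℕ) : ℕ∞) := by norm_num

/-- The type-`2` term of a basis: `q/(q + 1) − Φ·dem`. -/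
theorem wTwo_of_mem_basesOf {G B₀ : Finset α} {q : ℕ} (hB₀ : B₀ ∈ basesOf M G q) :
    wTwo M G B₀ q = (q : ℚ) / ((q : ℚ) + 1) - (((q : ℚ) + 2) / ((q : ℚ) + 1)) * GenQ.dem M G 2 B₀ := by
  rw [wTwo_eq]
  have h := mem_basesOf.1 hB₀
  have hI := indep_of_eRk_eq_of_card_eq h.2.1 h.2.2
  have hm : mTr M B₀ = q := by
    unfold mTr
    rw [coloopsOf_eq_self_of_indep hI, h.2.2]
  rw [hm]
  ring

omit [DecidableEq α] in
/-- A rank-`q` subset with more than `q` points is dependent. -/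
theorem not_indep_of_mem_Rq_of_card_ne {G B : Finset α} {q : ℕ} (hB : B ∈ Rq M G q) (hc : B.card ≠ q) :
    ¬ M.Indep (B : Set α) := by
  intro hI
  have h := hI.eRk_eq_encard
  rw [(mem_Rq.1 hB).2, Set.encard_coe_eq_coe_finsetCard] at h
  exact hc (by exact_mod_cast h.symm)

/-- The share `w(B)/nb(B)` of a spanning non-basis is nonnegative on a simple matroid. -/
theorem share_nonneg (hs : Simple M) {G B : Finset α} {q : ℕ} (hG : G ⊆ gr M) (hq : 2 ≤ q)
    (hB : B ∈ Rq M G q) (hc : B.card ≠ q) : 0 ≤ wTwo M G B q / (nb M G B q : ℚ) := by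
  apply div_nonneg
  · have h := typeTwo_term_pos_of_not_indep hs hG (mem_Rq.1 hB).1 (mem_Rq.1 hB).2 hq
      (not_indep_of_mem_Rq_of_card_ne hB hc)
    have hpos : (0 : ℚ) ≤ 2 / (((q : ℚ) - 1) * ((q : ℚ) + 1)) := by
      have : (2 : ℚ) ≤ q := by exact_mod_cast hq
      apply div_nonneg (by norm_num)
      apply mul_nonneg <;> linarith
    unfold wTwo
    linarith
  · exact_mod_cast Nat.zero_le _

/-! ## The shares of the `6`-point and `7`-point spanning sets at `q = 5` -/

/-- Arithmetic: `m ≤ 3`, `1 ≤ n ≤ 6 − m`, `e ≤ 1` give `1/36 ≤ (5/(1 + m) − (7/6) e)/n`. -/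
theorem arith_six (m n : ℕ) (e : ℚ) (hm : m ≤ 3) (hn1 : 1 ≤ n) (hn : n ≤ 6 - m) (he1 : e ≤ 1) :
    1 / 36 ≤ (5 / (1 + (m : ℚ)) - 7 / 6 * e) / (n : ℚ) := by
  have hn1' : (1 : ℚ) ≤ n := by exact_mod_cast hn1
  rw [le_div_iff₀ (by linarith)]
  interval_cases m <;> norm_num at hn ⊢ <;>
    (have hnq := (Nat.cast_le (α := ℚ)).2 hn; push_cast at hnq; nlinarith)

/-- Arithmetic: `m ≤ 3`, `1 ≤ n ≤ 6 − m` give `5/12 ≤ (5/(1 + m))/n`. -/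
theorem arith_six_free (m n : ℕ) (hm : m ≤ 3) (hn1 : 1 ≤ n) (hn : n ≤ 6 - m) :
    5 / 12 ≤ (5 / (1 + (m : ℚ))) / (n : ℚ) := by
  have hn1' : (1 : ℚ) ≤ n := by exact_mod_cast hn1
  rw [le_div_iff₀ (by linarith)]
  interval_cases m <;> norm_num at hn ⊢ <;>
    (have hnq := (Nat.cast_le (α := ℚ)).2 hn; push_cast at hnq; nlinarith)

/-- Arithmetic: `m ≤ 2`, `1 ≤ n ≤ C(7 − m, 2)`, `e ≤ 1` give `1/20 ≤ (5/(1 + m) − (7/6) e)/n`. -/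
theorem arith_seven (m n : ℕ) (e : ℚ) (hm : m ≤ 2) (hn1 : 1 ≤ n) (hn : n ≤ (7 - m).choose 2)
    (he1 : e ≤ 1) : 1 / 20 ≤ (5 / (1 + (m : ℚ)) - 7 / 6 * e) / (n : ℚ) := by
  have hn1' : (1 : ℚ) ≤ n := by exact_mod_cast hn1
  rw [le_div_iff₀ (by linarith)]
  interval_cases m <;> norm_num [Nat.choose] at hn ⊢ <;>
    (have hnq := (Nat.cast_le (α := ℚ)).2 hn; push_cast at hnq; nlinarith)

/-- Arithmetic: `m ≤ 2`, `1 ≤ n ≤ C(7 − m, 2)` give `1/6 ≤ (5/(1 + m))/n`. -/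
theorem arith_seven_free (m n : ℕ) (hm : m ≤ 2) (hn1 : 1 ≤ n) (hn : n ≤ (7 - m).choose 2) :
    1 / 6 ≤ (5 / (1 + (m : ℚ))) / (n : ℚ) := by
  have hn1' : (1 : ℚ) ≤ n := by exact_mod_cast hn1
  rw [le_div_iff₀ (by linarith)]
  interval_cases m <;> norm_num [Nat.choose] at hn ⊢ <;>
    (have hnq := (Nat.cast_le (α := ℚ)).2 hn; push_cast at hnq; nlinarith)


/-- `w(B) = 5/(1 + m(B)) − (7/6)·dem(B)` at `q = 5`. -/
theorem wTwo_five_eq (G B : Finset α) :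
    wTwo M G B 5 = 5 / (1 + (mTr M B : ℚ)) - 7 / 6 * GenQ.dem M G 2 B := by
  rw [wTwo_eq]
  push_cast
  ring

/-- A `6`-point rank-`5` subset of `G` has at most `3` coloops (a spanning non-basis of a simple matroid). -/
theorem mTr_le_three_of_card_eq_six (hs : Simple M) {G B : Finset α} (hG : G ⊆ gr M) (hB : B ∈ Rq M G 5)
    (hc : B.card = 6) : mTr M B ≤ 3 := by
  have h := mTr_add_two_le_of_spanning_nonbasis hs ((mem_Rq.1 hB).1.trans hG) (mem_Rq.1 hB).2 (by norm_num)
    (by omega)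
  omega

/-- The share of a `6`-point spanning set at `q = 5` is at least `1/36`. -/
theorem share_six_ge (hs : Simple M) {G B : Finset α} (hG : G ⊆ gr M) (hB : B ∈ Rq M G 5) (hc : B.card = 6) :
    1 / 36 ≤ wTwo M G B 5 / (nb M G B 5 : ℚ) := by
  have hm := mTr_le_three_of_card_eq_six hs hG hB hc
  have hnb := nb_le_choose (G := G) ((mem_Rq.1 hB).1.trans hG) (mem_Rq.1 hB).2
  rw [hc] at hnb
  have hchoose : (6 - mTr M B).choose (5 - mTr M B) = 6 - mTr M B := by
    have h6 : 6 - mTr M B = (5 - mTr M B) + 1 := by omega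
    rw [h6, Nat.choose_succ_self_right]
  rw [hchoose] at hnb
  rw [wTwo_five_eq]
  exact arith_six _ _ _ hm (one_le_nb hB) hnb (dem_le_one G 2 B)

/-- The share of a `6`-point spanning set whose complement has `≤ 1` point is at least `5/12`. -/
theorem share_six_ge_of_compl_le_one (hs : Simple M) {G B : Finset α} (hG : G ⊆ gr M) (hB : B ∈ Rq M G 5)
    (hc : B.card = 6) (hcompl : (G \ B).card ≤ 1) : 5 / 12 ≤ wTwo M G B 5 / (nb M G B 5 : ℚ) := by
  have hm := mTr_le_three_of_card_eq_six hs hG hB hc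
  have hnb := nb_le_choose (G := G) ((mem_Rq.1 hB).1.trans hG) (mem_Rq.1 hB).2
  rw [hc] at hnb
  have hchoose : (6 - mTr M B).choose (5 - mTr M B) = 6 - mTr M B := by
    have h6 : 6 - mTr M B = (5 - mTr M B) + 1 := by omega
    rw [h6, Nat.choose_succ_self_right]
  rw [hchoose] at hnb
  rw [wTwo_five_eq, dem_two_eq_zero_of_card_le_one hcompl, mul_zero, sub_zero]
  exact arith_six_free _ _ hm (one_le_nb hB) hnb

/-- A `7`-point rank-`5` subset has at most `2` coloops when every line of `M` has `≤ 3` points: three coloops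
would leave a `4`-point cyclic part of rank `2`, i.e. a line with `≥ 4` points. -/
theorem mTr_le_two_of_card_eq_seven (hs : Simple M) (hline : ∀ L ∈ flatsQ M 2, L.card ≤ 3) {G B : Finset α}
    (hG : G ⊆ gr M) (hB : B ∈ Rq M G 5) (hc : B.card = 7) : mTr M B ≤ 2 := by
  have hBg : B ⊆ gr M := (mem_Rq.1 hB).1.trans hG
  have hr := (mem_Rq.1 hB).2
  have h3 := mTr_add_two_le_of_spanning_nonbasis hs hBg hr (by norm_num) (by omega)
  by_contra hlt
  have hm3 : (coloopsOf M B).card = 3 := by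
    have : mTr M B = 3 := by omega
    exact this
  have hKB : coloopsOf M B ⊆ B := coloopsOf_subset B
  have hZcard : (B \ coloopsOf M B).card = 4 := by
    rw [Finset.card_sdiff_of_subset hKB, hc, hm3]
  have hrZ : M.eRk ((B \ coloopsOf M B : Finset α) : Set α) = 2 := by
    have h := eRk_sdiff_add_card_eq_of_subset_coloopsOf hBg (coloopsOf M B) (Finset.Subset.refl _)
    rw [hr, hm3] at h
    obtain ⟨k, hk⟩ := exists_eRk_eq_nat (M := M) (B \ coloopsOf M B)
    rw [hk] at h ⊢
    have hk' : k + 3 = 5 := by exact_mod_cast h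
    have : k = 2 := by omega
    rw [this]
    rfl
  have hZE : ((B \ coloopsOf M B : Finset α) : Set α) ⊆ M.E := by
    rw [← coe_gr M]
    exact Finset.coe_subset.2 (Finset.sdiff_subset.trans hBg)
  -- the line `cl(Z)`
  have hL : clF M (B \ coloopsOf M B) ∈ flatsQ M 2 := by
    rw [mem_flatsQ]
    refine ⟨?_, ?_, ?_⟩
    · intro x hx
      have hx' : x ∈ M.closure ((B \ coloopsOf M B : Finset α) : Set α) := by
        rw [← coe_clF]
        exact Finset.mem_coe.2 hx
      have := M.closure_subset_ground _ hx'
      rw [← coe_gr M] at this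
      exact Finset.mem_coe.1 this
    · rw [coe_clF]
      exact M.isFlat_closure _
    · rw [coe_clF, M.eRk_closure_eq, hrZ]
      rfl
  have hsub : B \ coloopsOf M B ⊆ clF M (B \ coloopsOf M B) := by
    intro x hx
    rw [← Finset.mem_coe, coe_clF]
    exact M.subset_closure _ hZE (Finset.mem_coe.2 hx)
  have h4 := Finset.card_le_card hsub
  have h3' := hline _ hL
  omega

/-- The share of a `7`-point spanning set at `q = 5` is at least `1/20` when lines have `≤ 3` points. -/
theorem share_seven_ge (hs : Simple M) (hline : ∀ L ∈ flatsQ M 2, L.card ≤ 3) {G B : Finset α} (hG : G ⊆ gr M)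
    (hB : B ∈ Rq M G 5) (hc : B.card = 7) : 1 / 20 ≤ wTwo M G B 5 / (nb M G B 5 : ℚ) := by
  have hm := mTr_le_two_of_card_eq_seven hs hline hG hB hc
  have hnb := nb_le_choose (G := G) ((mem_Rq.1 hB).1.trans hG) (mem_Rq.1 hB).2
  rw [hc] at hnb
  have hchoose : (7 - mTr M B).choose (5 - mTr M B) = (7 - mTr M B).choose 2 := by
    have h := Nat.choose_symm (n := 7 - mTr M B) (k := 5 - mTr M B) (by omega)
    rw [← h]
    congr 1
    omega
  rw [hchoose] at hnb
  rw [wTwo_five_eq]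
  exact arith_seven _ _ _ hm (one_le_nb hB) hnb (dem_le_one G 2 B)

/-- The share of a `7`-point spanning set whose complement has `≤ 1` point is at least `1/6`. -/
theorem share_seven_ge_of_compl_le_one (hs : Simple M) (hline : ∀ L ∈ flatsQ M 2, L.card ≤ 3) {G B : Finset α}
    (hG : G ⊆ gr M) (hB : B ∈ Rq M G 5) (hc : B.card = 7) (hcompl : (G \ B).card ≤ 1) :
    1 / 6 ≤ wTwo M G B 5 / (nb M G B 5 : ℚ) := by
  have hm := mTr_le_two_of_card_eq_seven hs hline hG hB hc
  have hnb := nb_le_choose (G := G) ((mem_Rq.1 hB).1.trans hG) (mem_Rq.1 hB).2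
  rw [hc] at hnb
  have hchoose : (7 - mTr M B).choose (5 - mTr M B) = (7 - mTr M B).choose 2 := by
    have h := Nat.choose_symm (n := 7 - mTr M B) (k := 5 - mTr M B) (by omega)
    rw [← h]
    congr 1
    omega
  rw [hchoose] at hnb
  rw [wTwo_five_eq, dem_two_eq_zero_of_card_le_one hcompl, mul_zero, sub_zero]
  exact arith_seven_free _ _ hm (one_le_nb hB) hnb

end PercRepro.Star
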